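import Summits.FinalStateConjecture.FinalStateConjecture.Theses.StarvedNecks
import Literature.Geometry.Lorentzian.TameBreathingCurve

/-!
# Line `SketchIdeator4` (card `compensator-not-boost`) — skeleton for crux `StarvedNecks.HonestFixedRadiusSettling`
(crux item stmt-FinalStateConjecture-13550; lead a1 = prover-line-stmt-FinalStateConjecture-13550-a1-0, 2026-08-16;
source: ideator-4 sketch `Cruxes/HonestFixedRadiusSettling/SketchIdeator4.lean` + card `Ideas/compensator-not-boost.md`).

THE LINE (targets the RE-TYPED crux G′ = tame genericity + `RaysStayInClosure`, lead c5's `RetypeKitC5`, and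
derives the filed crux G verbatim):

  `G ⇐ G′ ⇐ T1 ∧ T2`,  T3 = the selection `T1 → T2 → IsTameChristodoulouGeneric … (PT X) 1` (PROVED below),
  `T1 = stub_cleanedKicks`  (elliptic: rest-frame CK-cleaning of local kicks, tame in the parameter),
  `T2 = stub_robustCure`    (dynamical: robust local amplitude cure of every exceptional datum — the final-state
                             core in its tame shape; OPEN PROBLEM, crux-sized — see the lead's PICKED.md).

RESHAPE BY THE LEAD (a1, cycle 1) relative to the ideator's sketch: the radius/tolerance schedules `Λ, η` are
required CONTINUOUS ON `{c ≠ 0}` — demanded of T2's witnesses, granted to T1.  Reason (paper refutation of the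
sketch's T1, PICKED.md §2): with `Λ` merely a function, take `Λ` unbounded near some `c₀ ≠ 0`; then `Λ' ≥ Λ`
and joint smoothness of `F` and `G` force `F c₀ = G c₀` pointwise, so `IsClean e (G c₀) …` would demand that the
UNMODIFIED far field of `d` be weighted-`C⁶`-close to Schwarzschild and CK-flat to all orders on `e` — false for a
general admissible (`o₂(r⁻¹)`, `o₁(r⁻²)`) datum; likewise `η → 0` near `c₀` forces an exactly-Schwarzschild-ended
member at `c₀`.  T2's prover chooses its schedules and loses nothing by choosing them continuous off `0`
(robustness is monotone in the radius, tolerances may be shrunk continuously), so the composition T3 is unchanged.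

COMPOSITION (kernel-checked, sorry-free outside the two `stub_*`): `isTameChristodoulouGeneric_of_cleanedKicks`
(T3), `honestFixedRadiusSettlingT_of : CleanedKicks → RobustCure → G′`, `crux_of : CleanedKicks → RobustCure →
<ledger signature of 13550 verbatim>`, and THE SKELETON THEOREM
`HonestFixedRadiusSettling_of : Theses.StarvedNecks.HonestFixedRadiusSettling` (audited by name).
ANTI-VACUITY of T2's kick clause: `exists_isLocalKick` (every admissible datum carries a local kick — the breathing
curve, `InitialDataSet.exists_tame_selfWitness`).
-/

open scoped Manifold ContDiff ENNReal
open Filter Topology Set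

noncomputable section

namespace Summit.FinalStateConjecture.FinalStateConjecture.Cruxes.HonestFixedRadiusSettling.CompensatorNotBoost

open Literature.Geometry.Lorentzian

set_option linter.dupNamespace false
set_option linter.style.longLine false

/-- `PT X D` — the pointwise property whose TAME Christodoulou-genericity G′ asserts (lead c5's restatement of
item stmt-FinalStateConjecture-13550).  Text = RetypeKitC5.lean `HonestFixedRadiusSettlingT`, split at `∀ (X : Type)`. -/
def PT (X : Type) [TopologicalSpace X] [ChartedSpace E3 X] [IsManifold (𝓡 3) ∞ X] [T2Space X] [SecondCountableTopology X] [ConnectedSpace X] :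
    InitialDataSet (𝓡 3) X → Prop :=
  open Literature.Geometry.Lorentzian in open scoped ContDiff ENNReal in let Hc := ( fun (𝓢 : Spacetime.{0} 4) (O : Set 𝓢.carrier) (k : ℕ) (d : FinalStateDecomposition 𝓢 O k) (R₀ : ℝ) => let B := d.background; let t := fun i ↦ (B i).time; let r := fun i ↦ (B i).radius; let Ψ := d.chart; (∀ i, Kerr.IsSubextremal (d.mass i) (d.spin i) ∧ 100 * d.mass i ≤ R₀ ∧ 0 < ((d.motion i).1 : E4 ≃L[ℝ] E4) (E4.basisVector 0) 0) ∧ (∀ i (ϱ τ₂ : ℝ), R₀ ≤ ϱ → d.τ₀ < τ₂ → Ψ i '' {x | d.τ₀ < t i x.1 ∧ t i x.1 < τ₂ ∧ r i x.1 < ϱ} ⊆ 𝓢.metric.causalPast 𝓢.timeOrientation (Ψ i '' (B i).truncTimeSlab ϱ τ₂)) ∧ (∀ i (τ' : ℝ) (ϱ : ℝ → ℝ), Continuous ϱ → d.τ₀ < τ' → let A := Ψ i '' {x | τ' ≤ t i x.1 ∧ r i x.1 ≤ ϱ (t i x.1)}; closure A ∩ O ⊆ A) ∧ (∀ y : d.flatDomain,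 d.τ₀ < y.1 0 → 𝓢.timeOrientation.IsFutureDirected (mfderiv 𝓘(ℝ, E4) (𝓡 4) d.flatChart y (E4.basisVector 0))) ); let Hf := ( fun (𝓢 : Spacetime.{0} 4) (O : Set 𝓢.carrier) (k : ℕ) (d : FinalStateDecomposition 𝓢 O k) (R₀ : ℝ) => let B := d.background; let t := fun i ↦ (B i).time; let r := fun i ↦ (B i).radius; let Φ := d.flatChart; (∀ τ₂ : ℝ, d.τ₀ < τ₂ → Φ '' {y | d.τ₀ < y.1 0 ∧ y.1 0 < τ₂} ⊆ 𝓢.metric.causalPast 𝓢.timeOrientation (Φ '' (Minkowski.backgroundOn d.flatDomain).timeSlab τ₂)) ∧ (∀ τ' : ℝ, d.τ₀ < τ' → closure (Φ '' {y | τ' ≤ y.1 0 ∧ ∀ i, d.excision i (y.1 0) + 1 ≤ r i y.1}) ⊆ Φ '' {y | τ' ≤ y.1 0}) ∧ (∀ i, ∃ T : ℝ, supCkENorm (Subtype.val '' {x : (B i).domain | T ≤ t i x.1 ∧ R₀ ≤ r i x.1 ∧ ∀ j, j ≠ i → r i x.1 ≤ r j x.1}) 0 (𝓢.deviationExtend (B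 i) (d.chart i)) ≤ ENNReal.ofReal (1 / (10 * ‖(((d.motion i).1 : E4 ≃L[ℝ] E4) : E4 →L[ℝ] E4)‖ ^ 2))) ); (fun D ↦ (∃ 𝒟 : VacuumCauchyDevelopment D, 𝒟.IsMaximal) ∧ ∀ 𝒟 : VacuumCauchyDevelopment D, 𝒟.IsMaximal → HasCompleteNullInfinity 𝒟.toCauchyDevelopment ∧ ∃ (O : Set 𝒟.carrier) (d : FinalStateDecomposition 𝒟.toSpacetime O 4) (R₀ : ℝ), O = exteriorOf 𝒟.toCauchyDevelopment d.charted ∧ RaysStayInClosure 𝒟.toCauchyDevelopment O ∧ Hc 𝒟.toSpacetime O 4 d R₀ ∧ Hf 𝒟.toSpacetime O 4 d R₀)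

/-- G′ — `HonestFixedRadiusSettlingT`, written through `PT`. -/
def HonestFixedRadiusSettlingT : Prop :=
  ∀ (X : Type) [TopologicalSpace X] [ChartedSpace E3 X] [IsManifold (𝓡 3) ∞ X] [T2Space X] [SecondCountableTopology X] [ConnectedSpace X],
    InitialDataSet.IsTameChristodoulouGeneric (admissibleVacuumData X) (PT X) 1

/-- The split through `PT` is textual: G′ here is RetypeKitC5's `HonestFixedRadiusSettlingT` verbatim. -/
theorem honestFixedRadiusSettlingT_iff_retype :
    HonestFixedRadiusSettlingT ↔
      open Literature.Geometry.Lorentzian in open scoped ContDiff ENNReal in let Hc := ( fun (𝓢 : Spacetime.{0} 4) (O : Set 𝓢.carrier) (k : ℕ) (d : FinalStateDecomposition 𝓢 O k) (R₀ : ℝ) => let B := d.background; let t := fun i ↦ (B i).time; let r := fun i ↦ (B i).radius; let Ψ := d.chart; (∀ i, Kerr.IsSubextremal (d.mass i) (d.spin i) ∧ 100 * d.mass i ≤ R₀ ∧ 0 < ((d.motion i).1 : E4 ≃L[ℝ] E4) (E4.basisVector 0) 0) ∧ (∀ i (ϱ τ₂ : ℝ), R₀ ≤ ϱ → d.τ₀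 < τ₂ → Ψ i '' {x | d.τ₀ < t i x.1 ∧ t i x.1 < τ₂ ∧ r i x.1 < ϱ} ⊆ 𝓢.metric.causalPast 𝓢.timeOrientation (Ψ i '' (B i).truncTimeSlab ϱ τ₂)) ∧ (∀ i (τ' : ℝ) (ϱ : ℝ → ℝ), Continuous ϱ → d.τ₀ < τ' → let A := Ψ i '' {x | τ' ≤ t i x.1 ∧ r i x.1 ≤ ϱ (t i x.1)}; closure A ∩ O ⊆ A) ∧ (∀ y : d.flatDomain, d.τ₀ < y.1 0 → 𝓢.timeOrientation.IsFutureDirected (mfderiv 𝓘(ℝ, E4) (𝓡 4) d.flatChart y (E4.basisVector 0))) ); let Hf := ( fun (𝓢 : Spacetime.{0} 4) (O : Set 𝓢.carrier) (k : ℕ) (d : FinalStateDecomposition 𝓢 O k) (R₀ : ℝ) => let B := d.background; let t := fun i ↦ (B i).time; let r := fun i ↦ (B i).radius; let Φ := d.flatChart; (∀ τ₂ : ℝ, d.τ₀ < τ₂ → Φ '' {y | d.τ₀ < y.1 0 ∧ y.1 0 < τ₂} ⊆ 𝓢.metric.causalPast 𝓢.timeOrientation (Φ '' (Minkowski.backgroundOn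 d.flatDomain).timeSlab τ₂)) ∧ (∀ τ' : ℝ, d.τ₀ < τ' → closure (Φ '' {y | τ' ≤ y.1 0 ∧ ∀ i, d.excision i (y.1 0) + 1 ≤ r i y.1}) ⊆ Φ '' {y | τ' ≤ y.1 0}) ∧ (∀ i, ∃ T : ℝ, supCkENorm (Subtype.val '' {x : (B i).domain | T ≤ t i x.1 ∧ R₀ ≤ r i x.1 ∧ ∀ j, j ≠ i → r i x.1 ≤ r j x.1}) 0 (𝓢.deviationExtend (B i) (d.chart i)) ≤ ENNReal.ofReal (1 / (10 * ‖(((d.motion i).1 : E4 ≃L[ℝ] E4) : E4 →L[ℝ] E4)‖ ^ 2))) ); ∀ (X : Type) [TopologicalSpace X] [ChartedSpace E3 X] [IsManifold (𝓡 3) ∞ X] [T2Space X] [SecondCountableTopology X] [ConnectedSpace X], InitialDataSet.IsTameChristodoulouGeneric (admissibleVacuumData X) (fun D ↦ (∃ 𝒟 : VacuumCauchyDevelopment D, 𝒟.IsMaximal) ∧ ∀ 𝒟 : VacuumCauchyDevelopment D, 𝒟.IsMaximal → HasCompleteNullInfinity 𝒟.toCauchyDevelopment ∧ ∃ (O : Set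 𝒟.carrier) (d : FinalStateDecomposition 𝒟.toSpacetime O 4) (R₀ : ℝ), O = exteriorOf 𝒟.toCauchyDevelopment d.charted ∧ RaysStayInClosure 𝒟.toCauchyDevelopment O ∧ Hc 𝒟.toSpacetime O 4 d R₀ ∧ Hf 𝒟.toSpacetime O 4 d R₀) 1 :=
  Iff.rfl

section Clean

variable {X : Type} [TopologicalSpace X] [ChartedSpace E3 X] [IsManifold (𝓡 3) ∞ X]

/-- **Weighted `C^N × C^N` size of the deviation from a Schwarzschild end of mass `M'` beyond radius `R`**
(Dafermos–Rodnianski weights `‖x‖^{1+m}` on `Dᵐ(h − (1 + 2M'/r)δ)`, `‖x‖^{2+m}` on `Dᵐ k`, as in `AFEnd.wDist`;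
valued in `ℝ≥0∞`).  `cleanSize e D M' R N ≤ η` is the card's "clean beyond `R` to order `N` with tolerance `η`". -/
def cleanSize (e : AFEnd X) (D : InitialDataSet (𝓡 3) X) (M' R : ℝ) (N : ℕ) : ℝ≥0∞ :=
  (⨆ (m : ℕ) (_ : m ≤ N) (x : E3) (_ : R < ‖x‖),
      ENNReal.ofReal (‖x‖ ^ (1 + m)) *
        ‖iteratedFDeriv ℝ m
          (fun y ↦ e.hCoeff D y - (1 + 2 * M' / ‖y‖) • (innerSL ℝ : E3 →L[ℝ] E3 →L[ℝ] ℝ)) x‖ₑ) +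
    ⨆ (m : ℕ) (_ : m ≤ N) (x : E3) (_ : R < ‖x‖),
      ENNReal.ofReal (‖x‖ ^ (2 + m)) * ‖iteratedFDeriv ℝ m (e.kCoeff D) x‖ₑ

/-- `IsClean e d' Λ'' η` — the admitted far modifications of the card: beyond `2Λ''`, `d'` is `η`-close in weighted
`C⁶ × C⁶` to a Schwarzschild end of some mass `M'` and Christodoulou–Klainerman strongly asymptotically flat to all
orders with that mass. -/
def IsClean (e : AFEnd X) (d' : InitialDataSet (𝓡 3) X) (Λ'' η : ℝ) : Prop :=
  ∃ M' : ℝ, cleanSize e d' M' (2 * Λ'') 6 ≤ ENNReal.ofReal η ∧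
    ∀ n : ℕ, e.IsStronglyAsymptoticallyFlatWith d' M' (3 / 2) (5 / 2) n n

/-- `IsLocalKick d e K G` — a tame (on `e`), immersed, injective admissible one-parameter family through `d` whose
members equal `d` pointwise off the compact set `K`. -/
def IsLocalKick (d : InitialDataSet (𝓡 3) X) (e : AFEnd X) (K : Set X)
    (G : EuclideanSpace ℝ (Fin 1) → InitialDataSet (𝓡 3) X) : Prop :=
  InitialDataSet.IsTameDataFamily e 1 G ∧ InitialDataSet.IsImmersedAtZero 1 G ∧
    Function.Injective G ∧ G 0 = d ∧ (∀ c, G c ∈ admissibleVacuumData X) ∧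
    ∀ c x, x ∉ K → (G c).h.inner x = d.h.inner x ∧ (G c).k x = d.k x

variable (X)

/-- **T1 `CleanedKicksOn X` — rest-frame CK-cleaning of local kicks (the elliptic stub; lead's reshape: the
schedules are continuous off `0`).**  For every admissible `d`, end `e`, compact `K`, local kick `G`, radius
schedule `Λ` and tolerance schedule `η > 0`, both continuous on `{c ≠ 0}`, there are radii
`Λ' ≥ Λ` and a tame immersed injective admissible family `F` through `d` such that for `c ≠ 0`: `F c = G c` off
`e.far (Λ' c)`, `e.wDist (F c) (G c) ≤ η c`, and `F c` is `η c`-clean beyond `2 Λ' c`. -/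
def CleanedKicksOn : Prop :=
  ∀ d ∈ admissibleVacuumData X, ∀ (e : AFEnd X) (K : Set X), IsCompact K →
    ∀ G : EuclideanSpace ℝ (Fin 1) → InitialDataSet (𝓡 3) X, IsLocalKick d e K G →
      ∀ Λ η : EuclideanSpace ℝ (Fin 1) → ℝ, ContinuousOn Λ {c | c ≠ 0} → ContinuousOn η {c | c ≠ 0} →
        (∀ c, c ≠ 0 → 0 < η c) →
        ∃ (Λ' : EuclideanSpace ℝ (Fin 1) → ℝ) (F : EuclideanSpace ℝ (Fin 1) → InitialDataSet (𝓡 3) X),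
          (∀ c, Λ c ≤ Λ' c) ∧
          InitialDataSet.IsTameDataFamily e 1 F ∧ InitialDataSet.IsImmersedAtZero 1 F ∧
          Function.Injective F ∧ F 0 = d ∧ (∀ c, F c ∈ admissibleVacuumData X) ∧
          ∀ c, c ≠ 0 →
            (∀ x, x ∉ e.far (Λ' c) → (F c).h.inner x = (G c).h.inner x ∧ (F c).k x = (G c).k x) ∧
            e.wDist (F c) (G c) ≤ ENNReal.ofReal (η c) ∧ IsClean e (F c) (Λ' c) (η c)

/-- **T2 `RobustCureOn X P` — robust local amplitude cure (the dynamical core, tame shape; lead's reshape: the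
schedules are continuous off `0`).**  Every admissible `d` failing `P` carries an end `e`, a compact `K`, a local
kick `G`, radii `Λ` and tolerances `η > 0`, both continuous on `{c ≠ 0}`, such that every
admissible datum agreeing with `G c`, `c ≠ 0`, off `e.far Λ''` for some `Λ'' ≥ Λ c`, `η c`-close to `G c` in
`e.wDist`, and `η c`-clean beyond `2Λ''`, satisfies `P`. -/
def RobustCureOn (P : InitialDataSet (𝓡 3) X → Prop) : Prop :=
  ∀ d ∈ admissibleVacuumData X, ¬ P d →
    ∃ (e : AFEnd X) (K : Set X), IsCompact K ∧
      ∃ G : EuclideanSpace ℝ (Fin 1) → InitialDataSet (𝓡 3) X, IsLocalKick d e K G ∧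
        ∃ Λ η : EuclideanSpace ℝ (Fin 1) → ℝ, ContinuousOn Λ {c | c ≠ 0} ∧ ContinuousOn η {c | c ≠ 0} ∧
          (∀ c, c ≠ 0 → 0 < η c) ∧
          ∀ c, c ≠ 0 → ∀ Λ'' : ℝ, Λ c ≤ Λ'' → ∀ d' ∈ admissibleVacuumData X,
            (∀ x, x ∉ e.far Λ'' → d'.h.inner x = (G c).h.inner x ∧ d'.k x = (G c).k x) →
            e.wDist d' (G c) ≤ ENNReal.ofReal (η c) → IsClean e d' Λ'' (η c) → P d'

variable {X}

/-- **T3 (selection, PROVED).**  Cleaned kicks + robust cure ⇒ tame Christodoulou genericity of `P` in the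
admissible class: the witness through an exceptional `d` is the cleaning `F` (T1) of the kick `G` (T2) beyond T2's
own radii and within T2's own tolerances. -/
theorem isTameChristodoulouGeneric_of_cleanedKicks (P : InitialDataSet (𝓡 3) X → Prop)
    (hC : CleanedKicksOn X) (hR : RobustCureOn X P) :
    InitialDataSet.IsTameChristodoulouGeneric (admissibleVacuumData X) P 1 := by
  intro d hd
  obtain ⟨e, K, hK, G, hG, Λ, η, hΛc, hηc, hη, hcure⟩ := hR d hd.1 hd.2
  obtain ⟨Λ', F, hΛ', hFt, hFi, hFinj, hF0, hFmem, hF⟩ := hC d hd.1 e K hK G hG Λ η hΛc hηc hη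
  refine ⟨e, F, hFt, hFi, hF0, hFinj, hFmem, ?_⟩
  intro c hc hmem
  obtain ⟨hagree, hw, hclean⟩ := hF c hc
  exact hmem.2 (hcure c hc (Λ' c) (hΛ' c) (F c) (hFmem c) hagree hw hclean)

end Clean

/-- T1 for every admissible `3`-manifold. -/
def CleanedKicks : Prop :=
  ∀ (X : Type) [TopologicalSpace X] [ChartedSpace E3 X] [IsManifold (𝓡 3) ∞ X] [T2Space X] [SecondCountableTopology X] [ConnectedSpace X], CleanedKicksOn X

/-- T2 for the property `PT` of G′, for every admissible `3`-manifold. -/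
def RobustCure : Prop :=
  ∀ (X : Type) [TopologicalSpace X] [ChartedSpace E3 X] [IsManifold (𝓡 3) ∞ X] [T2Space X] [SecondCountableTopology X] [ConnectedSpace X], RobustCureOn X (PT X)

/-- **G′ from T1 ∧ T2 (PROVED).** -/
theorem honestFixedRadiusSettlingT_of (hC : CleanedKicks) (hR : RobustCure) : HonestFixedRadiusSettlingT :=
  fun X _ _ _ _ _ _ ↦ isTameChristodoulouGeneric_of_cleanedKicks (PT X) (hC X) (hR X)

/-- **The filed crux G from T1 ∧ T2 (PROVED)** — conclusion = the ledger signature of item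
stmt-FinalStateConjecture-13550 (`Theses.StarvedNecks.HonestFixedRadiusSettling`) VERBATIM (plain genericity, no
rays clause), via G′ (forget tameness, immersion and `RaysStayInClosure`; the step is lead c5's
`honestFixedRadiusSettling_of_T` verbatim). -/
theorem crux_of (hC : CleanedKicks) (hR : RobustCure) :
    open Literature.Geometry.Lorentzian in open scoped ContDiff ENNReal in let Hc := ( fun (𝓢 : Spacetime.{0} 4) (O : Set 𝓢.carrier) (k : ℕ) (d : FinalStateDecomposition 𝓢 O k) (R₀ : ℝ) => let B := d.background; let t := fun i ↦ (B i).time; let r := fun i ↦ (B i).radius; let Ψ := d.chart; (∀ i, Kerr.IsSubextremal (d.mass i) (d.spin i) ∧ 100 * d.mass i ≤ R₀ ∧ 0 < ((d.motion i).1 : E4 ≃L[ℝ] E4) (E4.basisVector 0) 0) ∧ (∀ i (ϱ τ₂ : ℝ), R₀ ≤ ϱ → d.τ₀ < τ₂ → Ψ i '' {x | d.τ₀ < t i x.1 ∧ t i x.1 < τ₂ ∧ r i x.1 < ϱ} ⊆ 𝓢.metric.causalPast 𝓢.timeOrientation (Ψ i '' (B i).truncTimeSlab ϱ τ₂)) ∧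 (∀ i (τ' : ℝ) (ϱ : ℝ → ℝ), Continuous ϱ → d.τ₀ < τ' → let A := Ψ i '' {x | τ' ≤ t i x.1 ∧ r i x.1 ≤ ϱ (t i x.1)}; closure A ∩ O ⊆ A) ∧ (∀ y : d.flatDomain, d.τ₀ < y.1 0 → 𝓢.timeOrientation.IsFutureDirected (mfderiv 𝓘(ℝ, E4) (𝓡 4) d.flatChart y (E4.basisVector 0))) ); let Hf := ( fun (𝓢 : Spacetime.{0} 4) (O : Set 𝓢.carrier) (k : ℕ) (d : FinalStateDecomposition 𝓢 O k) (R₀ : ℝ) => let B := d.background; let t := fun i ↦ (B i).time; let r := fun i ↦ (B i).radius; let Φ := d.flatChart; (∀ τ₂ : ℝ, d.τ₀ < τ₂ → Φ '' {y | d.τ₀ < y.1 0 ∧ y.1 0 < τ₂} ⊆ 𝓢.metric.causalPast 𝓢.timeOrientation (Φ '' (Minkowski.backgroundOn d.flatDomain).timeSlab τ₂)) ∧ (∀ τ' : ℝ, d.τ₀ < τ' → closure (Φ '' {y | τ' ≤ y.1 0 ∧ ∀ i, d.excision i (y.1 0) + 1 ≤ r i y.1}) ⊆ Φ '' {y | τ'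 ≤ y.1 0}) ∧ (∀ i, ∃ T : ℝ, supCkENorm (Subtype.val '' {x : (B i).domain | T ≤ t i x.1 ∧ R₀ ≤ r i x.1 ∧ ∀ j, j ≠ i → r i x.1 ≤ r j x.1}) 0 (𝓢.deviationExtend (B i) (d.chart i)) ≤ ENNReal.ofReal (1 / (10 * ‖(((d.motion i).1 : E4 ≃L[ℝ] E4) : E4 →L[ℝ] E4)‖ ^ 2))) ); ∀ (X : Type) [TopologicalSpace X] [ChartedSpace E3 X] [IsManifold (𝓡 3) ∞ X] [T2Space X] [SecondCountableTopology X] [ConnectedSpace X], InitialDataSet.IsChristodoulouGeneric (admissibleVacuumData X) (fun D ↦ (∃ 𝒟 : VacuumCauchyDevelopment D, 𝒟.IsMaximal) ∧ ∀ 𝒟 : VacuumCauchyDevelopment D, 𝒟.IsMaximal → HasCompleteNullInfinity 𝒟.toCauchyDevelopment ∧ ∃ (O : Set 𝒟.carrier) (d : FinalStateDecomposition 𝒟.toSpacetime O 4) (R₀ : ℝ), O = exteriorOf 𝒟.toCauchyDevelopment d.charted ∧ Hc 𝒟.toSpacetime O 4 d R₀ ∧ Hf 𝒟.toSpacetime O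 4 d R₀) 1 := by
  have h : HonestFixedRadiusSettlingT := honestFixedRadiusSettlingT_of hC hR
  intro Hc Hf X _ _ _ _ _ _
  have mono : ∀ (P Q : Literature.Geometry.Lorentzian.InitialDataSet (𝓡 3) X → Prop),
      (∀ D ∈ Literature.Geometry.Lorentzian.admissibleVacuumData X, P D → Q D) →
      Literature.Geometry.Lorentzian.InitialDataSet.IsChristodoulouGeneric
        (Literature.Geometry.Lorentzian.admissibleVacuumData X) P 1 →
      Literature.Geometry.Lorentzian.InitialDataSet.IsChristodoulouGeneric
        (Literature.Geometry.Lorentzian.admissibleVacuumData X) Q 1 := by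
    intro P Q hPQ hP d hd
    obtain ⟨F, hF, h0, hinj, hmem, hE⟩ := hP d ⟨hd.1, fun h ↦ hd.2 (hPQ d hd.1 h)⟩
    exact ⟨F, hF, h0, hinj, hmem, fun c hc hc' ↦ hE c hc ⟨hc'.1, fun h ↦ hc'.2 (hPQ _ hc'.1 h)⟩⟩
  refine mono _ _ ?_ (h X).isChristodoulouGeneric
  rintro D - ⟨hex, hall⟩
  refine ⟨hex, fun 𝒟 h𝒟 ↦ ?_⟩
  obtain ⟨hscri, O, dd, R₀, hO, -, hcore, hfar⟩ := hall 𝒟 h𝒟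
  exact ⟨hscri, O, dd, R₀, hO, hcore, hfar⟩

/-! ## Anti-vacuity of the kick clause -/

section AntiVacuity

variable {X : Type} [TopologicalSpace X] [ChartedSpace E3 X] [IsManifold (𝓡 3) ∞ X] [T2Space X]
  [SecondCountableTopology X] [ConnectedSpace X]

/-- **Every admissible datum carries a local kick** (so T2's `∃ G, IsLocalKick d e K G` clause is satisfiable at
every datum and T2 is never blocked at the kick): the breathing curve of `d` far out on its sole end
(`InitialDataSet.exists_tame_selfWitness`) is tame, immersed, injective, admissible and equal to `d` off one
compact set. -/
theorem exists_isLocalKick {d : InitialDataSet (𝓡 3) X} (hd : d ∈ admissibleVacuumData X) :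
    ∃ (e : AFEnd X) (K : Set X) (G : EuclideanSpace ℝ (Fin 1) → InitialDataSet (𝓡 3) X),
      IsCompact K ∧ IsLocalKick d e K G := by
  obtain ⟨e, F, hFt, hFi, hF0, hFinj, hFmem, K, hK, hagree⟩ := InitialDataSet.exists_tame_selfWitness hd
  exact ⟨e, K, F, hK, hFt, hFi, hFinj, hF0, hFmem, fun c x hx ↦ hagree c x hx⟩

end AntiVacuity

/-! ## The registered stubs -/

/-- **stub T1 (elliptic; XL, NOT in print in this rest-frame/compensator form — see PICKED.md):** rest-frame
CK-cleaning of local kicks, tame in the parameter, for every admissible `3`-manifold. -/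
theorem stub_cleanedKicks : CleanedKicks := by
  sorry

/-- **stub T2 (dynamical; OPEN PROBLEM — the final-state core in tame shape, crux-sized, handed back to the
planner by lead a1):** robust local amplitude cure of the property `PT` of G′. -/
theorem stub_robustCure : RobustCure := by
  sorry

/-- **THE SKELETON THEOREM** — the crux BY NAME from the two stubs (`crux_of` has the crux's body verbatim as its
type; the named `def` δ-unfolds to it). -/
theorem HonestFixedRadiusSettling_of : Theses.StarvedNecks.HonestFixedRadiusSettling :=
  crux_of stub_cleanedKicks stub_robustCure

end Summit.FinalStateConjecture.FinalStateConjecture.Cruxes.HonestFixedRadiusSettling.CompensatorNotBoost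

end
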